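/-
Copyright (c) 2026. All rights reserved.
Released under Apache 2.0 license as described in the file LICENSE.
Authors: abc-iut cell, prover seat abc-iut-w5-d180 (wave 5, gen 7).
-/
import Literature.IUT.LogVolume.TensorPacketLicenceCellOrders
import Literature.IUT.LogVolume.UnitLogValuationProfileShell
import Literature.IUT.LogVolume.UnitLogMaxNorm
import Literature.IUT.LogVolume.DifferentEstimatesCorollaries
import HarnessLib

/-!
# The U2 cell CLOSED at TIE-FREE places: `(p − 1) ∤ e` ⇒ `R_in = ⌊e/(p−1)⌋ + 1`, `R_out = p^{a₀} − e·a₀`, and the cell is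
# `e·⌊(M − (|I|−1)·D − |I|·R_in)/e⌋ + |I|·R_out ≤ m_q` with NO lattice input left

abc-iut cell, seat abc-iut-w5-d180 (D-0079 sub-cell R-W «WINDOW Θ-SIDE INEQUALITY», lane U, row «W:U2-CELL-TIEFREE-CLOSED»).  PROOF-ONLY
file (no definitions, no named `Prop` facts).  It composes three landed results BY NAME: this seat's integer orders form of
abc-iut-c312-5's exact per-summand cell (`iota_smul_subset_packetHull_orbit_iota_smul_iff_orders`, `TensorPacketLicenceCellOrders`),
abc-iut-rp-d4's sharp inner ball of the log-unit lattice at `(p−1) ∤ e` (`ValuationProfile.closedBall_zpow_subset_logUnits_of_lt` /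
`ValuationProfile.not_closedBall_zpow_subset_logUnits_of_mul_lt`, `UnitLogValuationProfileShell`) and abc-iut-c312-3's envelope = outer
radius (`LogEnvelope.forall_mem_logUnits_norm_le_envelope` / `LogEnvelope.exists_mem_logUnits_norm_eq_envelope`, `UnitLogMaxNorm`).

* §1 `exists_shellRadii_witnesses_of_not_dvd` — for a local field `K/ℚ_p` with `(p−1) ∤ e` and a turning point `a₀` of `e`
  (`p^a(p−1) < e` for `a < a₀`, `e ≤ p^{a₀}(p−1)`; strict automatically), abc-iut-c312-5's binder conditions are WITNESSED by
  `c_in := ϖ^{⌊e/(p−1)⌋+1}` (inner ball + «the next ball is not inside») and a log-unit `c_out` of norm `‖ϖ‖^{p^{a₀} − e·a₀}` (largest);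
* §2 **`iota_smul_subset_packetHull_orbit_iff_orders_of_not_dvd`** / **`…factorwiseOrbit…_of_not_dvd`** — the per-summand cell at the
  diagonal packet of `K` decided by the CLOSED integer predicate
  `e·((M − (|I|−1)·D − |I|·(⌊e/(p−1)⌋+1)) / e) + |I|·(p^{a₀} − e·a₀) ≤ m_q`;
* §3 `…_of_not_dvd_of_not_dvd` — if moreover `p ∤ e` (classically tame but possibly deep: `e ≥ p` allowed), `D = e − 1`
  (`differentOrd_eq_of_not_dvd`), so the ONLY inputs are `(p, e, a₀, |I|, M, m_q)`.

SANITY (numbers): `p = 7`, `e = 11` (`a₀ = 1`): `R_in = 2`, `R_out = −4`, `D = 10`; `|I| = 6`, `M = 25·m_q`: inhabited for `m_q ≤ 3`, refuted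
from `m_q = 4` (`11·⌊(100−62)/11⌋ − 24 = 9 > 4`).  `e ≤ p − 2` gives `⌊e/(p−1)⌋ = 0`, `a₀ = 0`: `R_in = R_out = 1` — the tame dichotomy.
HONEST SCOPE: the (Ind2)/hull are the tree's typings of disputed-corpus constructions; the cell is a STRONGER-THAN-PRINT per-summand
reading of [IUTchIII] Cor. 3.12 Step (xi-f); nothing here bears on the printed inequality; no side taken on Cor. 3.12 or on any author.
[cite: Mochizuki2012, IUTchIV Prop. 1.1 p. 9, Prop. 1.2 (i)(ii) p. 10] [cite: NeukirchANT1999, Ch. II (5.5)] [cite: DupuyHilado2025, §4.9, §4.12]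
[claim: Mochizuki2012, status: disputed].
-/

noncomputable section

open Set Metric Module Function
open scoped Pointwise TensorProduct NormedField

namespace Literature.IUT.LogVolume

open Literature.NumberTheory.GaloisRepresentations.Ultrametric

variable (p : ℕ) [hp : Fact p.Prime]

/-! ## 1. The shell-radius witnesses at a tie-free place -/

section Witnesses

variable {K : Type} [NontriviallyNormedField K] [NormedAlgebra ℚ_[p] K] [IsUltrametricDist K] [ProperSpace K]

/-- Arithmetic of `R_in = ⌊e/(p−1)⌋ + 1` at `(p−1) ∤ e`: `⌊e/(p−1)⌋·(p−1) < e < (⌊e/(p−1)⌋ + 1)·(p−1)`.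
[cite: NeukirchANT1999, Ch. II (5.5)] -/
private theorem floor_mul_lt_and_lt (hnd : ¬ (p - 1) ∣ absRamificationIdx p K) :
    ((absRamificationIdx p K / (p - 1) : ℕ) : ℤ) * ((p : ℤ) - 1) < absRamificationIdx p K ∧
      (absRamificationIdx p K : ℤ) < (((absRamificationIdx p K / (p - 1) : ℕ) : ℤ) + 1) * ((p : ℤ) - 1) := by
  have hp1 : 1 ≤ p := hp.out.one_lt.le
  have hq0 : 0 < p - 1 := by have := hp.out.two_le; omega
  have hcast : ((p : ℤ) - 1) = ((p - 1 : ℕ) : ℤ) := by rw [Nat.cast_sub hp1, Nat.cast_one]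
  rw [hcast]
  constructor
  · have hle := Nat.div_mul_le_self (absRamificationIdx p K) (p - 1)
    have hne : absRamificationIdx p K / (p - 1) * (p - 1) ≠ absRamificationIdx p K :=
      fun h => hnd (Dvd.intro_left _ h)
    have h : absRamificationIdx p K / (p - 1) * (p - 1) < absRamificationIdx p K := lt_of_le_of_ne hle hne
    exact_mod_cast h
  · have h : absRamificationIdx p K < (absRamificationIdx p K / (p - 1) + 1) * (p - 1) := by
      rw [Nat.add_mul, one_mul]
      exact Nat.lt_div_mul_add hq0
    exact_mod_cast h

/-- A turning point of a tie-free index is STRICT: `(p−1) ∤ e` and `e ≤ p^{a₀}(p−1)` give `e < p^{a₀}(p−1)`.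
[cite: NeukirchANT1999, Ch. II (5.5)] -/
private theorem lt_turning_of_not_dvd (hnd : ¬ (p - 1) ∣ absRamificationIdx p K) {a₀ : ℕ}
    (hhi : (absRamificationIdx p K : ℤ) ≤ (p : ℤ) ^ a₀ * ((p : ℤ) - 1)) :
    (absRamificationIdx p K : ℤ) < (p : ℤ) ^ a₀ * ((p : ℤ) - 1) := by
  refine lt_of_le_of_ne hhi fun h => hnd ?_
  have hp1 : 1 ≤ p := hp.out.one_lt.le
  have h' : (absRamificationIdx p K : ℤ) = ((p ^ a₀ * (p - 1) : ℕ) : ℤ) := by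
    rw [h]; push_cast; rw [Nat.cast_sub hp1, Nat.cast_one]
  exact ⟨p ^ a₀, by rw [mul_comm]; exact_mod_cast h'⟩

/-- **The shell-radius WITNESSES at a tie-free place.**  For `(p−1) ∤ e(K/ℚ_p)`, a norm uniformiser `ϖ` and a turning point `a₀`
of `e`: `c_in := ϖ^{⌊e/(p−1)⌋+1}` satisfies abc-iut-c312-5's inner-radius binders (`c_in·𝒪 ⊆ log_p(𝒪^×)` by abc-iut-rp-d4's inner ball;
some `w ∉ log_p(𝒪^×)` with `‖w‖·‖ϖ‖ ≤ ‖c_in‖` by rp-d4's «the ball `𝔪^{⌊e/(p−1)⌋}` is NOT inside»), and some log-unit `c_out` of norm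
`‖ϖ‖^{p^{a₀} − e·a₀}` satisfies the outer-radius binders (abc-iut-c312-3's envelope, attained since the turning point is strict).
[cite: NeukirchANT1999, Ch. II (5.5)] -/
theorem exists_shellRadii_witnesses_of_not_dvd (hnd : ¬ (p - 1) ∣ absRamificationIdx p K) {ϖ : Kˣ} (hϖ : IsUniformizer ϖ)
    {a₀ : ℕ} (hlo : ∀ a < a₀, (p : ℤ) ^ a * ((p : ℤ) - 1) < absRamificationIdx p K)
    (hhi : (absRamificationIdx p K : ℤ) ≤ (p : ℤ) ^ a₀ * ((p : ℤ) - 1)) :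
    ∃ cin cout : K,
      (∀ o : K, ‖o‖ ≤ 1 → cin * o ∈ logUnits K) ∧
      (∃ (ϖ' : Kˣ) (w : K), IsUniformizer ϖ' ∧ w ∉ logUnits K ∧ ‖w‖ * ‖(ϖ' : K)‖ ≤ ‖cin‖) ∧
      cout ∈ logUnits K ∧ (∀ z ∈ logUnits K, ‖z‖ ≤ ‖cout‖) ∧
      ‖cin‖ = ‖(ϖ : K)‖ ^ (((absRamificationIdx p K / (p - 1) : ℕ) : ℤ) + 1) ∧
      ‖cout‖ = ‖(ϖ : K)‖ ^ ((p : ℤ) ^ a₀ - (absRamificationIdx p K : ℤ) * (a₀ : ℤ)) := by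
  obtain ⟨h1, h2⟩ := floor_mul_lt_and_lt p hnd
  have hϖ0 : ‖(ϖ : K)‖ ≠ 0 := norm_ne_zero_iff.mpr ϖ.ne_zero
  set r : ℤ := ((absRamificationIdx p K / (p - 1) : ℕ) : ℤ) + 1 with hr
  -- outer witness
  obtain ⟨z, hz, hzn⟩ := LogEnvelope.exists_mem_logUnits_norm_eq_envelope p hϖ hlo (lt_turning_of_not_dvd p hnd hhi)
  refine ⟨(ϖ : K) ^ r, z, fun o ho => ?_, ?_, hz, fun w hw => ?_, norm_zpow _ _, hzn⟩
  · -- inner ball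
    refine ValuationProfile.closedBall_zpow_subset_logUnits_of_lt p hϖ h2 ?_
    rw [mem_closedBall_zero_iff, norm_mul, norm_zpow]
    calc ‖(ϖ : K)‖ ^ r * ‖o‖ ≤ ‖(ϖ : K)‖ ^ r * 1 := mul_le_mul_of_nonneg_left ho (zpow_nonneg (norm_nonneg _) _)
      _ = ‖(ϖ : K)‖ ^ r := mul_one _
  · -- the next ball is not inside
    have hr1 : (r - 1) * ((p : ℤ) - 1) < absRamificationIdx p K := by rw [hr, add_sub_cancel_right]; exact h1
    obtain ⟨w, hw, hwn⟩ := Set.not_subset.mp (ValuationProfile.not_closedBall_zpow_subset_logUnits_of_mul_lt p hnd hϖ hr1)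
    refine ⟨ϖ, w, hϖ, hwn, ?_⟩
    rw [mem_closedBall_zero_iff] at hw
    rw [norm_zpow]
    calc ‖w‖ * ‖(ϖ : K)‖ ≤ ‖(ϖ : K)‖ ^ (r - 1) * ‖(ϖ : K)‖ := mul_le_mul_of_nonneg_right hw (norm_nonneg _)
      _ = ‖(ϖ : K)‖ ^ r := by rw [← zpow_add_one₀ hϖ0, sub_add_cancel]
  · rw [hzn]
    exact LogEnvelope.forall_mem_logUnits_norm_le_envelope p hϖ hlo hhi w hw

end Witnesses

/-! ## 2. The cell at a tie-free place: the CLOSED integer predicate -/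

section Cell

variable {I : Type} [Fintype I] [DecidableEq I] [Nonempty I]
variable {K : Type} [NontriviallyNormedField K] [NormedAlgebra ℚ_[p] K] [IsUltrametricDist K] [ProperSpace K]

/-- **THE U2 CELL AT A TIE-FREE PLACE, CLOSED FORM (Dupuy–Hilado's full (Ind2)).**  `(p−1) ∤ e`, `a₀` a turning point of `e`,
`differentOrd = D/e`, `‖t_Θ‖ = ‖ϖ‖^M`, `‖t_q‖ = ‖ϖ‖^{m_q}`, diagonal packet of `K` with `|I|` slots:
**cell ⟺ `e·((M − (|I|−1)·D − |I|·(⌊e/(p−1)⌋+1)) / e) + |I|·(p^{a₀} − e·a₀) ≤ m_q`.**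
[cite: DupuyHilado2025, §4.9, §4.12] [cite: Mochizuki2012, IUTchIV Prop. 1.1 p. 9, Prop. 1.2 (i)(ii) p. 10] [cite: NeukirchANT1999, Ch. II (5.5)] -/
theorem iota_smul_subset_packetHull_orbit_iff_orders_of_not_dvd (hnd : ¬ (p - 1) ∣ absRamificationIdx p K) {ϖ : Kˣ}
    (hϖ : IsUniformizer ϖ) {a₀ : ℕ} (hlo : ∀ a < a₀, (p : ℤ) ^ a * ((p : ℤ) - 1) < absRamificationIdx p K)
    (hhi : (absRamificationIdx p K : ℤ) ≤ (p : ℤ) ^ a₀ * ((p : ℤ) - 1)) {D : ℕ}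
    (hD : differentOrd p K = (D : ℝ) / absRamificationIdx p K)
    (b b' : I) {tΘ tq : K} {M mq : ℤ} (hΘ : ‖tΘ‖ = ‖(ϖ : K)‖ ^ M) (hq : ‖tq‖ = ‖(ϖ : K)‖ ^ mq) :
    iota p (fun _ : I => K) b' tq • (normalizedPacket p (fun _ : I => K) : Set (PacketAlgebra p (fun _ : I => K))) ⊆
        packetHull p (fun _ : I => K) (⋃ g : indTwo p (fun _ : I => K),
          g • (iota p (fun _ : I => K) b tΘ • (normalizedPacket p (fun _ : I => K) : Set (PacketAlgebra p (fun _ : I => K))))) ↔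
      (absRamificationIdx p K : ℤ) *
            ((M - (Fintype.card I - 1 : ℕ) * (D : ℤ) -
                Fintype.card I * (((absRamificationIdx p K / (p - 1) : ℕ) : ℤ) + 1)) / absRamificationIdx p K) +
          Fintype.card I * ((p : ℤ) ^ a₀ - (absRamificationIdx p K : ℤ) * (a₀ : ℤ)) ≤ mq := by
  obtain ⟨cin, cout, hin, hmax, houtΛ, hdom, hRin, hRout⟩ := exists_shellRadii_witnesses_of_not_dvd p hnd hϖ hlo hhi
  exact iota_smul_subset_packetHull_orbit_iota_smul_iff_orders p hϖ hD hin hmax houtΛ hdom hRin hRout b b' hΘ hq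

/-- **THE U2 CELL AT A TIE-FREE PLACE, CLOSED FORM — FACTORWISE (Ind2)** ([IUTchIII] Thm. 3.11 (i)): the same integer predicate.
[cite: Mochizuki2012, IUTchIII Thm. 3.11 (i) (Ind2) p. 154] [cite: DupuyHilado2025, §4.9] [cite: NeukirchANT1999, Ch. II (5.5)] -/
theorem iota_smul_subset_packetHull_factorwiseOrbit_iff_orders_of_not_dvd (hnd : ¬ (p - 1) ∣ absRamificationIdx p K) {ϖ : Kˣ}
    (hϖ : IsUniformizer ϖ) {a₀ : ℕ} (hlo : ∀ a < a₀, (p : ℤ) ^ a * ((p : ℤ) - 1) < absRamificationIdx p K)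
    (hhi : (absRamificationIdx p K : ℤ) ≤ (p : ℤ) ^ a₀ * ((p : ℤ) - 1)) {D : ℕ}
    (hD : differentOrd p K = (D : ℝ) / absRamificationIdx p K)
    (b b' : I) {tΘ tq : K} {M mq : ℤ} (hΘ : ‖tΘ‖ = ‖(ϖ : K)‖ ^ M) (hq : ‖tq‖ = ‖(ϖ : K)‖ ^ mq) :
    iota p (fun _ : I => K) b' tq • (normalizedPacket p (fun _ : I => K) : Set (PacketAlgebra p (fun _ : I => K))) ⊆
        packetHull p (fun _ : I => K) (⋃ g ∈ {g : ∀ _ : I, K ≃ₗ[ℚ_[p]] K | ∀ i, g i '' logUnits K = logUnits K},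
          (PiTensorProduct.congr g : PacketAlgebra p (fun _ : I => K) ≃ₗ[ℚ_[p]] PacketAlgebra p (fun _ : I => K)) ''
            (iota p (fun _ : I => K) b tΘ • (normalizedPacket p (fun _ : I => K) : Set (PacketAlgebra p (fun _ : I => K))))) ↔
      (absRamificationIdx p K : ℤ) *
            ((M - (Fintype.card I - 1 : ℕ) * (D : ℤ) -
                Fintype.card I * (((absRamificationIdx p K / (p - 1) : ℕ) : ℤ) + 1)) / absRamificationIdx p K) +
          Fintype.card I * ((p : ℤ) ^ a₀ - (absRamificationIdx p K : ℤ) * (a₀ : ℤ)) ≤ mq := by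
  obtain ⟨cin, cout, hin, hmax, houtΛ, hdom, hRin, hRout⟩ := exists_shellRadii_witnesses_of_not_dvd p hnd hϖ hlo hhi
  exact iota_smul_subset_packetHull_factorwiseOrbit_iota_smul_iff_orders p hϖ hD hin hmax houtΛ hdom hRin hRout b b' hΘ hq

/-! ## 3. Classically tame but possibly deep places (`p ∤ e`, `(p−1) ∤ e`): `D = e − 1`, nothing else to supply -/

/-- `p ∤ e ⇒ differentOrd = (e−1)/e` in the `(D : ℕ)/e` form with `D = e − 1`. [cite: SerreLocalFields1979, Ch. III §6 Prop. 13] -/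
private theorem differentOrd_eq_natSub_div (hpe : ¬ p ∣ absRamificationIdx p K) :
    differentOrd p K = ((absRamificationIdx p K - 1 : ℕ) : ℝ) / absRamificationIdx p K := by
  rw [differentOrd_eq_of_not_dvd p K hpe, Nat.cast_sub (absRamificationIdx_pos p K), Nat.cast_one]

/-- **THE U2 CELL AT A PLACE WITH `p ∤ e` AND `(p−1) ∤ e` — ALL INPUTS EXPLICIT, FACTORWISE (Ind2).**  With `a₀` a turning point of `e`:
**cell ⟺ `e·((M − (|I|−1)·(e−1) − |I|·(⌊e/(p−1)⌋+1)) / e) + |I|·(p^{a₀} − e·a₀) ≤ m_q`** — e.g. every bad place `x₀ | 7` of the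
`λ_k` family with `7 ∤ e_w`, `6 ∤ e_w`.  [cite: Mochizuki2012, IUTchIII Thm. 3.11 (i) (Ind2) p. 154; IUTchIV Prop. 1.2 (iii) p. 11]
[cite: SerreLocalFields1979, Ch. III §6 Prop. 13] [cite: NeukirchANT1999, Ch. II (5.5)] -/
theorem iota_smul_subset_packetHull_factorwiseOrbit_iff_orders_of_not_dvd_of_not_dvd (hpe : ¬ p ∣ absRamificationIdx p K)
    (hnd : ¬ (p - 1) ∣ absRamificationIdx p K) {ϖ : Kˣ} (hϖ : IsUniformizer ϖ) {a₀ : ℕ}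
    (hlo : ∀ a < a₀, (p : ℤ) ^ a * ((p : ℤ) - 1) < absRamificationIdx p K)
    (hhi : (absRamificationIdx p K : ℤ) ≤ (p : ℤ) ^ a₀ * ((p : ℤ) - 1))
    (b b' : I) {tΘ tq : K} {M mq : ℤ} (hΘ : ‖tΘ‖ = ‖(ϖ : K)‖ ^ M) (hq : ‖tq‖ = ‖(ϖ : K)‖ ^ mq) :
    iota p (fun _ : I => K) b' tq • (normalizedPacket p (fun _ : I => K) : Set (PacketAlgebra p (fun _ : I => K))) ⊆
        packetHull p (fun _ : I => K) (⋃ g ∈ {g : ∀ _ : I, K ≃ₗ[ℚ_[p]] K | ∀ i, g i '' logUnits K = logUnits K},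
          (PiTensorProduct.congr g : PacketAlgebra p (fun _ : I => K) ≃ₗ[ℚ_[p]] PacketAlgebra p (fun _ : I => K)) ''
            (iota p (fun _ : I => K) b tΘ • (normalizedPacket p (fun _ : I => K) : Set (PacketAlgebra p (fun _ : I => K))))) ↔
      (absRamificationIdx p K : ℤ) *
            ((M - (Fintype.card I - 1 : ℕ) * ((absRamificationIdx p K - 1 : ℕ) : ℤ) -
                Fintype.card I * (((absRamificationIdx p K / (p - 1) : ℕ) : ℤ) + 1)) / absRamificationIdx p K) +
          Fintype.card I * ((p : ℤ) ^ a₀ - (absRamificationIdx p K : ℤ) * (a₀ : ℤ)) ≤ mq :=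
  iota_smul_subset_packetHull_factorwiseOrbit_iff_orders_of_not_dvd p hnd hϖ hlo hhi (differentOrd_eq_natSub_div p hpe) b b' hΘ hq

/-- The same for Dupuy–Hilado's full (Ind2). [cite: DupuyHilado2025, §4.9, §4.12] [cite: SerreLocalFields1979, Ch. III §6 Prop. 13] -/
theorem iota_smul_subset_packetHull_orbit_iff_orders_of_not_dvd_of_not_dvd (hpe : ¬ p ∣ absRamificationIdx p K)
    (hnd : ¬ (p - 1) ∣ absRamificationIdx p K) {ϖ : Kˣ} (hϖ : IsUniformizer ϖ) {a₀ : ℕ}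
    (hlo : ∀ a < a₀, (p : ℤ) ^ a * ((p : ℤ) - 1) < absRamificationIdx p K)
    (hhi : (absRamificationIdx p K : ℤ) ≤ (p : ℤ) ^ a₀ * ((p : ℤ) - 1))
    (b b' : I) {tΘ tq : K} {M mq : ℤ} (hΘ : ‖tΘ‖ = ‖(ϖ : K)‖ ^ M) (hq : ‖tq‖ = ‖(ϖ : K)‖ ^ mq) :
    iota p (fun _ : I => K) b' tq • (normalizedPacket p (fun _ : I => K) : Set (PacketAlgebra p (fun _ : I => K))) ⊆
        packetHull p (fun _ : I => K) (⋃ g : indTwo p (fun _ : I => K),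
          g • (iota p (fun _ : I => K) b tΘ • (normalizedPacket p (fun _ : I => K) : Set (PacketAlgebra p (fun _ : I => K))))) ↔
      (absRamificationIdx p K : ℤ) *
            ((M - (Fintype.card I - 1 : ℕ) * ((absRamificationIdx p K - 1 : ℕ) : ℤ) -
                Fintype.card I * (((absRamificationIdx p K / (p - 1) : ℕ) : ℤ) + 1)) / absRamificationIdx p K) +
          Fintype.card I * ((p : ℤ) ^ a₀ - (absRamificationIdx p K : ℤ) * (a₀ : ℤ)) ≤ mq :=
  iota_smul_subset_packetHull_orbit_iff_orders_of_not_dvd p hnd hϖ hlo hhi (differentOrd_eq_natSub_div p hpe) b b' hΘ hq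

end Cell

end Literature.IUT.LogVolume

end
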